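import Summits.AnomalousDissipation.AnomalousDissipation.Theorems.SolenoidalFractalHomogenisationLagrangianStepSidebandLadderCrushSlotNuExists
import Summits.AnomalousDissipation.AnomalousDissipation.Theorems.SolenoidalFractalHomogenisationLagrangianStepSidebandLadderCrushRate
import HarnessLib

/-!
# K1L_D `stub_D1_V0thg` (stmt-AnomalousDissipation-27980), R3′ lane — the ν-scaled ladder crush UNIFORMLY OVER THE QUASI-STATIC STRETCH
# (constants independent of the stretch factor `s`; at `s = 1/ν = 1/r³` the full-slot factor is `≤ K·ν`)

Helper file of route `SolenoidalFractalHomogenisation` (`--supports stmt-AnomalousDissipation-27980 --as helper`; one-generation hand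
`leafhand-ad-solenoidalfractalh-1` g0, road E-c).  The D1 chain replays the design word quasi-statically stretched, `W₁ = W.stretch s` with `s ∝ 1/ν`
(`Sideband.psiStar`), so the consumer of the crush needs constants that do NOT depend on the stretch.  They don't: `stretch` only rescales the slot
durations (`((W.stretch s hs).phase i).τ = s·τᵢ`, while `e`, `m`, `φ`, hence `slotAmp`, are unchanged — all `rfl`), and the constants of
`Sideband.ladder_crush_slot_nu` are built from `êᵢ·z₀`, `‖αᵢ‖`, `|mᵢ|²` and the window shape only.
* `ladder_crush_stretch_nu_exists` — `∃ Ccr ccr C_R > 0` (ν- and s-free) with, for EVERY stretch `s > 0`, every admissible `R, r, 𝔸, γ₁` and every solution on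
  the stretched slot from the ladder subspace: `‖u(start + sτᵢ)‖² ≤ Ccr·exp(−ccr·r²·sτᵢ/2)·‖u(start)‖²` (provided `2/r ≤ sτᵢ`).
* `ladder_crush_quasistatic_nu` — at the quasi-static stretch `s = 1/r³ = 1/ν`: `∃ K C_R > 0` with `‖u(start + τᵢ/r³)‖² ≤ K·r³·‖u(start)‖² = K·ν·‖u(start)‖²`
  (provided `2r² ≤ τᵢ`; `crushFactor_le_linear`) — the `σ_R = 1` smallness the R3′-2/R3′-4 bookkeeping consumes.
No definitions, no sorry.  NOT a proof of `stub_D1_V0thg`, of K1L_D or of AD; rung F-D1.A0 infrastructure.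
-/

set_option linter.dupNamespace false -- single-conjunct summit: `Summit.AnomalousDissipation.AnomalousDissipation.…` is the mandated namespace

noncomputable section

namespace Summit.AnomalousDissipation.AnomalousDissipation.Theorems.SolenoidalFractalHomogenisation.LagrangianStep.Sideband

open Set Complex
open scoped InnerProductSpace
open Literature.Analysis Literature.Analysis.FunctionSpaces Literature.Analysis.FunctionSpaces.Torus
open Literature.Analysis.FluidPDE Literature.Analysis.FluidPDE.Torus Literature.Analysis.FluidPDE.LatticeShear

variable {k₀ : ℕ}

set_option maxHeartbeats 400000 in -- pre-budgeted (ops-buildfix rule): large statement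
/-- **ν-SCALED FULL-SLOT CRUSH, UNIFORM IN THE STRETCH**: constants `Ccr, ccr, C_R > 0` depending on the word `W`, the slot `i`, the ladder base point `z₀` and
the window shape `l, h, β` only, valid for the slot `i` of EVERY stretched word `W.stretch s` (`s > 0`). [cite: BedrossianCotiZelati2017, §2 (hypocoercivity, enhanced dissipation)] -/
theorem ladder_crush_stretch_nu_exists (W : LatticeWord k₀) (i : Fin k₀) (z₀ : Fin 3 → ℤ)
    (hhop : ∑ a, (W.phase i).e a * (z₀ a : ℝ) ≠ 0) {M : ℝ} (hM : ∀ j, |((W.phase i).m j : ℝ)| ≤ M)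
    {l h β : ℝ} (hl : 0 < l) (hh : 0 < h) (hβ : 0 ≤ β)
    {a m₂ S₀ Mo : ℝ} (ha : a = 2 * Real.pi * |∑ a, (W.phase i).e a * (z₀ a : ℝ)| * ‖slotAmp W i‖)
    (hm₂ : m₂ = freqNormSq (W.phase i).m)
    (hS₀ : S₀ = 4 * (4 * a ^ 2) + 16 * (8 * a ^ 2 * (1 + m₂) * h / l) + 1) (hMo : Mo = 8 * a ^ 2 * (1 + m₂))
    (hF : 128 * (β / (2 * l) * (1 + Mo)) ^ 2 ≤ S₀) :
    ∃ Ccr ccr CR : ℝ, 0 < Ccr ∧ 0 < ccr ∧ 0 < CR ∧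
      ∀ {s : ℝ} (hs : 0 < s) {R : ℕ}, M < R → ∀ {r : ℝ}, 0 < r → r ≤ 1 → CR ≤ ((R : ℝ) - M) * r ^ 2 →
      ∀ {𝔸 : Torus.Visc4 (Fin 3)}, Torus.NearIso 𝔸 (r ^ 3 * l) (r ^ 3 * h) → Torus.OddSmall 𝔸 (r ^ 3 * β) → ∀ {γ₁ : ℝ}, 0 ≤ γ₁ →
      ∀ {u : ℝ → Space R}, 2 / r ≤ s * (W.phase i).τ →
        (∀ t ∈ Icc ((W.stretch s hs).start i) ((W.stretch s hs).start i + s * (W.phase i).τ),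
          HasDerivAt u (((gen (W.stretch s hs) 𝔸 γ₁ R t).restrictScalars ℝ) (u t)) t) →
        u ((W.stretch s hs).start i) ∈ ladderSub R (ladder z₀ (W.phase i).m) →
        ‖u ((W.stretch s hs).start i + s * (W.phase i).τ)‖ ^ 2 ≤
          Ccr * Real.exp (-(ccr * r ^ 2 * (s * (W.phase i).τ / 2))) * ‖u ((W.stretch s hs).start i)‖ ^ 2 := by
  have ha0 : 0 < a := by rw [ha]; exact ladderCoupling_pos W i z₀ hhop
  have hm₂0 : 0 ≤ m₂ := by rw [hm₂]; exact freqNormSq_nonneg _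
  have hS₀0 : 0 < S₀ := by rw [hS₀]; positivity
  set κ : ℝ := (4 * Real.pi ^ 2 * l / (28 * S₀ ^ 2)) ^ (1 / 3 : ℝ) with hκ
  have hκ0 : 0 < κ := Real.rpow_pos_of_pos (by positivity) _
  have hκ3 : κ ^ 3 = 4 * Real.pi ^ 2 * l / (28 * S₀ ^ 2) := by
    rw [hκ, ← Real.rpow_natCast, ← Real.rpow_mul (by positivity)]
    norm_num
  set CR : ℝ := 24 * κ * a ^ 2 / (Real.pi ^ 2 * l) with hCR
  set K₁ : ℝ := (1 + m₂) / (4 * a ^ 2) * (2 + 2 * a ^ 2) with hK₁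
  set K₃ : ℝ := (1 + m₂) / (4 * a ^ 2) * (6 * a ^ 2 / (4 * Real.pi ^ 2 * l * CR) + 4 * a ^ 2 / (4 * Real.pi ^ 2 * l * CR ^ 2)) with hK₃
  set c : ℝ := min (2 * Real.pi ^ 2 * l / (21 * S₀ * κ ^ 2)) (min (4 * Real.pi ^ 2 * l * a ^ 2 / (21 * (1 + m₂))) (min (1 / (6 * K₃)) (κ / (3 * K₁))))
    with hc
  have hCR0 : 0 < CR := by positivity
  have hK₁0 : 0 < K₁ := by positivity
  have hK₃0 : 0 < K₃ := by positivity
  have hc0 : 0 < c := lt_min (by positivity) (lt_min (by positivity) (lt_min (by positivity) (by positivity)))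
  refine ⟨3 * (1 + 7 * S₀ * κ ^ 2 / (8 * Real.pi ^ 2 * l)) * Real.exp c, c, CR, by positivity, hc0, hCR0, ?_⟩
  intro s hs R hMR r hr hr1 hbox 𝔸 h𝔸 hoddA γ₁ hγ₁ u hτ hu h0
  -- the stretched word has the same `e`, `m`, `φ`, `slotAmp`; only `τ ↦ s·τ`
  exact (ladder_crush_slot_nu (W.stretch s hs) i z₀ hhop hM hMR hr hr1 hl hh hβ h𝔸 hoddA hγ₁ hτ hu h0 ha0 ha hm₂ hS₀ hMo hκ0 hκ3
    hCR hK₁ hK₃ hc hF hbox).2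

set_option maxHeartbeats 400000 in -- pre-budgeted (ops-buildfix rule): large statement
/-- **QUASI-STATIC STRETCH `s = 1/ν`: the full-slot crush factor is `≤ K·ν`** (`ν = r³`): constants `K, C_R > 0` (depending on `W, i, z₀, l, h, β` only) with
`‖u(start + τᵢ/r³)‖² ≤ K·r³·‖u(start)‖²` for every admissible `R, r, 𝔸, γ₁` and every solution on the stretched slot from the ladder subspace, provided
`2r² ≤ τᵢ`. [cite: BedrossianCotiZelati2017, §2 (hypocoercivity, enhanced dissipation)] -/
theorem ladder_crush_quasistatic_nu (W : LatticeWord k₀) (i : Fin k₀) (z₀ : Fin 3 → ℤ)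
    (hhop : ∑ a, (W.phase i).e a * (z₀ a : ℝ) ≠ 0) {M : ℝ} (hM : ∀ j, |((W.phase i).m j : ℝ)| ≤ M)
    {l h β : ℝ} (hl : 0 < l) (hh : 0 < h) (hβ : 0 ≤ β)
    {a m₂ S₀ Mo : ℝ} (ha : a = 2 * Real.pi * |∑ a, (W.phase i).e a * (z₀ a : ℝ)| * ‖slotAmp W i‖)
    (hm₂ : m₂ = freqNormSq (W.phase i).m)
    (hS₀ : S₀ = 4 * (4 * a ^ 2) + 16 * (8 * a ^ 2 * (1 + m₂) * h / l) + 1) (hMo : Mo = 8 * a ^ 2 * (1 + m₂))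
    (hF : 128 * (β / (2 * l) * (1 + Mo)) ^ 2 ≤ S₀) :
    ∃ K CR : ℝ, 0 < K ∧ 0 < CR ∧
      ∀ {R : ℕ}, M < R → ∀ {r : ℝ} (hr : 0 < r), r ≤ 1 → CR ≤ ((R : ℝ) - M) * r ^ 2 → 2 * r ^ 2 ≤ (W.phase i).τ →
      ∀ {𝔸 : Torus.Visc4 (Fin 3)}, Torus.NearIso 𝔸 (r ^ 3 * l) (r ^ 3 * h) → Torus.OddSmall 𝔸 (r ^ 3 * β) → ∀ {γ₁ : ℝ}, 0 ≤ γ₁ →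
      ∀ {u : ℝ → Space R},
        (∀ t ∈ Icc ((W.stretch (1 / r ^ 3) (by positivity)).start i) ((W.stretch (1 / r ^ 3) (by positivity)).start i + 1 / r ^ 3 * (W.phase i).τ),
          HasDerivAt u (((gen (W.stretch (1 / r ^ 3) (by positivity)) 𝔸 γ₁ R t).restrictScalars ℝ) (u t)) t) →
        u ((W.stretch (1 / r ^ 3) (by positivity)).start i) ∈ ladderSub R (ladder z₀ (W.phase i).m) →
        ‖u ((W.stretch (1 / r ^ 3) (by positivity)).start i + 1 / r ^ 3 * (W.phase i).τ)‖ ^ 2 ≤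
          K * r ^ 3 * ‖u ((W.stretch (1 / r ^ 3) (by positivity)).start i)‖ ^ 2 := by
  obtain ⟨Ccr, ccr, CR, hCcr, hccr, hCR, hall⟩ := ladder_crush_stretch_nu_exists W i z₀ hhop hM hl hh hβ ha hm₂ hS₀ hMo hF
  have hτ0 : 0 < (W.phase i).τ := (W.phase i).τ_pos
  refine ⟨Ccr * (48 / (ccr * (W.phase i).τ) ^ 3), CR, by positivity, hCR, ?_⟩
  intro R hMR r hr hr1 hbox hτr 𝔸 h𝔸 hoddA γ₁ hγ₁ u hu h0
  have hr3 : 0 < r ^ 3 := by positivity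
  have hτ : 2 / r ≤ 1 / r ^ 3 * (W.phase i).τ := by
    rw [div_le_iff₀ hr, show 1 / r ^ 3 * (W.phase i).τ * r = (W.phase i).τ / r ^ 2 by field_simp, le_div_iff₀ (by positivity)]
    linarith
  have h := hall (one_div_pos.mpr hr3) hMR hr hr1 hbox h𝔸 hoddA hγ₁ hτ hu h0
  have hexp : Real.exp (-(ccr * r ^ 2 * (1 / r ^ 3 * (W.phase i).τ / 2))) ≤ 48 / (ccr * (W.phase i).τ) ^ 3 * r ^ 3 := by
    rw [show 1 / r ^ 3 * (W.phase i).τ / 2 = (W.phase i).τ / r ^ 3 / 2 by ring]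
    exact crushFactor_le_linear hccr hτ0 hr
  calc ‖u ((W.stretch (1 / r ^ 3) (by positivity)).start i + 1 / r ^ 3 * (W.phase i).τ)‖ ^ 2
      ≤ Ccr * Real.exp (-(ccr * r ^ 2 * (1 / r ^ 3 * (W.phase i).τ / 2))) * ‖u ((W.stretch (1 / r ^ 3) (by positivity)).start i)‖ ^ 2 := h
    _ ≤ Ccr * (48 / (ccr * (W.phase i).τ) ^ 3 * r ^ 3) * ‖u ((W.stretch (1 / r ^ 3) (by positivity)).start i)‖ ^ 2 :=
        mul_le_mul_of_nonneg_right (mul_le_mul_of_nonneg_left hexp hCcr.le) (sq_nonneg _)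
    _ = Ccr * (48 / (ccr * (W.phase i).τ) ^ 3) * r ^ 3 * ‖u ((W.stretch (1 / r ^ 3) (by positivity)).start i)‖ ^ 2 := by ring

end Summit.AnomalousDissipation.AnomalousDissipation.Theorems.SolenoidalFractalHomogenisation.LagrangianStep.Sideband

end
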